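import Summits.Ventures.Crystal3D.Theorems.StickyWulffConstantTextureBuildCompositionT
import HarnessLib

/-!
# TB-1: the tiling identity WITH SLACK — unowned half-defects may pay for the cover's losses
# (lane T, crux `TextureLiminfV5`, stmt-Ventures-23912; `stub_TB_cover` repair census TB-1-g19 §2.4)

HONEST FRAMING. Venture `Summits/Ventures/Crystal3D` (cell `crystal3d-full`), route `route-Ventures-StickyWulffConstant`, helper `--supports` the
law-v5 crux `TextureLiminfV5` (stmt-Ventures-23912).  Pure finite bookkeeping over the landed interface (…TextureBuildCrustedCover,
…TextureBuildCompositionT); census-free, standard axioms.  No cover is built, no texture is built; rung F-C1 not moved.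

WHY (TB-1-g19 §2.4).  `CrustedCover.tiling₂` sums the per-piece lines over the pairwise disjoint OWNERS (tents' owned balls, crust balls, cells' balls) and
then DROPS the half-defects of every ball that no piece owns (`sum_halfDefect_le_contactDeficiency`).  Those dropped half-defects are exactly what a
configuration pays for features the cover chooses not to certify (interior junk, lock lines, obstructing line defects), and the level-2 composition goes
through verbatim if the cover's losses are bounded by `θ·N^{2/3}` PLUS that slack.  This file records the exact form:
* `CrustedCover.owner / ownedUnion / unownedSlack` — the owners indexed by `(Fin ng ⊕ Fin nc) ⊕ Fin nk`, their union, and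
  `unownedSlack := Σ_{a ∈ X′ ∖ ownedUnion} halfDefect X′ a ≥ 0`;
* **`CrustedCover.tiling₂_slack`** (`R₀ ≥ 1`): `tentBudget + cellBudget + unownedSlack ≤ (6N′ − C(x′)) + tilingLoss₂` (the identity
  `Σ_{X′} halfDefect = D(X′)` instead of the inequality);
* `CrustedCover.tentBudget_add_chargeSum_le₂_slack` — with the wall law: `tentBudget + chargeSum + unownedSlack ≤ (6N − C(x)) + tilingLoss₂ + rimSum`;
* **`shadowTheoremSatAtomicV5_of_crustedAdh_slack`** / `textureBuildT_of_stubs_slack` — the level-2 composition with the WEAKER «TB-cover» target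
  `tilingLoss₂ + rimSum + gapCost ≤ θ·N^{2/3} + unownedSlack` (adhesion hypothesis arbitrary / T-form), «TB-energy» unchanged.
WHAT THIS IS NOT: no new piece kind, no cover; it only weakens what `stub_TB_cover` has to deliver.  F-C1 not moved.
-/

noncomputable section

open scoped BigOperators InnerProductSpace ENNReal
open MeasureTheory

namespace Summit.Ventures.Crystal3D.Cruxes.TextureLiminf.TexShadow

open Summit.Ventures.Crystal3D Summit.Ventures.Crystal3D.Theorems Finset
open Literature.MathematicalPhysics.StatisticalMechanics (IsHaggSeq fccStacking barlowStacking contactDeficiency)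

namespace CrustedCover

variable {C R₀ : ℝ} {N : ℕ} {x : Fin N → E3}

/-- the OWNERS of a crusted cover: tents' owned balls, crust balls, cells' balls -/
def owner (cc : CrustedCover C R₀ N x) : (Fin cc.ng ⊕ Fin cc.nc) ⊕ Fin cc.nk → Finset E3
  | Sum.inl (Sum.inl f) => (cc.tent f).owned cc.X'
  | Sum.inl (Sum.inr c) => cc.cB c
  | Sum.inr k => (cc.cell k).act

/-- the union of all owned ball sets -/
def ownedUnion (cc : CrustedCover C R₀ N x) : Finset E3 := Finset.univ.biUnion cc.owner

/-- the SLACK: half-defects of the balls no piece owns -/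
def unownedSlack (cc : CrustedCover C R₀ N x) : ℝ := ∑ a ∈ cc.X' \ cc.ownedUnion, halfDefect cc.X' a

/-- Every owner is a set of configuration balls. -/
theorem owner_subset (cc : CrustedCover C R₀ N x) (i : (Fin cc.ng ⊕ Fin cc.nc) ⊕ Fin cc.nk) : cc.owner i ⊆ cc.X' := by
  rcases i with (f | c) | k
  · exact (cc.tent f).owned_subset cc.X'
  · exact fun b hb => (Finset.mem_sdiff.1 (cc.hcB c hb)).1
  · exact (cc.cell k).act_subset

/-- Owners are pairwise disjoint. -/
theorem owner_disjoint (cc : CrustedCover C R₀ N x) :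
    ∀ i ∈ (Finset.univ : Finset ((Fin cc.ng ⊕ Fin cc.nc) ⊕ Fin cc.nk)),
      ∀ j ∈ (Finset.univ : Finset ((Fin cc.ng ⊕ Fin cc.nc) ⊕ Fin cc.nk)), i ≠ j → Disjoint (cc.owner i) (cc.owner j) := by
  rintro ((f | c) | k) - ((g | c') | l) - hne
  · exact cc.hdisjTT f g (fun h => hne (by rw [h]))
  · exact (cc.hBT c' f).symm
  · exact cc.hdisjTC f l
  · exact cc.hBT c g
  · exact cc.hBB c c' (fun h => hne (by rw [h]))
  · exact cc.hBC c l
  · exact (cc.hdisjTC g k).symm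
  · exact (cc.hBC c' k).symm
  · exact cc.hdisjCC k l (fun h => hne (by rw [h]))

/-- The owned union is a set of configuration balls. -/
theorem ownedUnion_subset (cc : CrustedCover C R₀ N x) : cc.ownedUnion ⊆ cc.X' :=
  Finset.biUnion_subset.2 fun i _ => cc.owner_subset i

/-- The slack is nonnegative. -/
theorem unownedSlack_nonneg (cc : CrustedCover C R₀ N x) : 0 ≤ cc.unownedSlack :=
  Finset.sum_nonneg fun a _ => halfDefect_nonneg cc.X' cc.X'_sep a

/-- The exact half-defect identity split along the owners: `Σ_i Σ_{owner i} halfDefect + unownedSlack = D(X′)`. -/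
theorem sum_owner_halfDefect_add_slack (cc : CrustedCover C R₀ N x) :
    ∑ i, ∑ a ∈ cc.owner i, halfDefect cc.X' a + cc.unownedSlack = contactDeficiency cc.X' := by
  classical
  have h1 : ∑ i, ∑ a ∈ cc.owner i, halfDefect cc.X' a = ∑ a ∈ cc.ownedUnion, halfDefect cc.X' a := by
    unfold ownedUnion
    rw [Finset.sum_biUnion cc.owner_disjoint]
  rw [h1, contactDeficiency_eq_sum_halfDefect]
  unfold unownedSlack
  rw [← Finset.sum_union Finset.disjoint_sdiff, Finset.union_sdiff_of_subset cc.ownedUnion_subset]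

/-- **THE TILING IDENTITY WITH CRUSTS AND SLACK** (`R₀ ≥ 1`): `tentBudget + cellBudget + unownedSlack ≤ (6N′ − C(x′)) + tilingLoss₂`. -/
theorem tiling₂_slack (cc : CrustedCover C R₀ N x) (hR₀ : 1 ≤ R₀) :
    cc.tentBudget + cc.cellBudget + cc.unownedSlack ≤ (6 * (cc.N' : ℝ) - (numContacts cc.x' : ℝ)) + cc.tilingLoss₂ := by
  classical
  have hhd := cc.sum_owner_halfDefect_add_slack
  rw [Fintype.sum_sum_type, Fintype.sum_sum_type] at hhd
  have htent : cc.tentBudget ≤ ∑ f, ∑ a ∈ (cc.tent f).owned cc.X', halfDefect cc.X' a + ∑ f, cc.tentRimSharp f := by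
    unfold CellCover.tentBudget
    rw [← Finset.sum_add_distrib]
    exact Finset.sum_le_sum fun f _ => cc.tentBudget_le_sharp f
  have hcell : cc.cellBudget ≤ ∑ k, ∑ a ∈ (cc.cell k).act, halfDefect cc.X' a + ∑ k, (cc.cell k).tilingRim := by
    unfold CellCover.cellBudget
    rw [← Finset.sum_add_distrib]
    exact Finset.sum_le_sum fun k _ => (cc.cell k).budget_le hR₀
  have hcrust : ∑ c, cc.crustTerm c ≤ ∑ c, ∑ b ∈ cc.cB c, halfDefect cc.X' b + ∑ c, cc.crustRim c := by
    rw [← Finset.sum_add_distrib]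
    exact Finset.sum_le_sum fun c _ => cc.crustTerm_le c
  rw [← cc.contactDeficiency_X']
  unfold tilingLoss₂
  have hown₁ : ∑ f, ∑ a ∈ cc.owner (Sum.inl (Sum.inl f)), halfDefect cc.X' a = ∑ f, ∑ a ∈ (cc.tent f).owned cc.X', halfDefect cc.X' a := rfl
  have hown₂ : ∑ c, ∑ a ∈ cc.owner (Sum.inl (Sum.inr c)), halfDefect cc.X' a = ∑ c, ∑ b ∈ cc.cB c, halfDefect cc.X' b := rfl
  have hown₃ : ∑ k, ∑ a ∈ cc.owner (Sum.inr k), halfDefect cc.X' a = ∑ k, ∑ a ∈ (cc.cell k).act, halfDefect cc.X' a := rfl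
  linarith

/-- **The discrete half with crusts and slack**: `tentBudget + chargeSum + unownedSlack ≤ (6N − C(x)) + tilingLoss₂ + rimSum` (wall law at `(C, R₀)`, `R₀ ≥ 1`). -/
theorem tentBudget_add_chargeSum_le₂_slack (cc : CrustedCover C R₀ N x) (hR₀ : 1 ≤ R₀)
    (hW : ∀ (σ₁ σ₂ : ℤ → ℤ), IsHaggSeq σ₁ → IsHaggSeq σ₂ →
      ∀ (L₁ L₂ : E3 ≃ₗᵢ[ℝ] E3) (s₁ s₂ : E3) (A₁ A₂ : ℤ → (E3 ≃ₗᵢ[ℝ] E3)),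
      (∀ i, ∃ u : E3, bilayer L₁ s₁ σ₁ i ⊆ (fun r => A₁ i r + u) '' fccRef) →
      (∀ j, ∃ u : E3, bilayer L₂ s₂ σ₂ j ⊆ (fun r => A₂ j r + u) '' fccRef) →
      ∀ (c : ℤ → ℤ → ℝ) (m : ℤ → ℤ → E3), (∀ i j, 0 ≤ c i j) → (∀ i j, c i j ≤ 13 / 25) →
      (∀ i j, CoAx (A₁ i) (A₂ j) → A₁ i '' fccRef ≠ A₂ j '' fccRef →
        SharedAxis (m i j) (A₁ i) (A₂ j) ∧ c i j ≤ 1 / 2 * Real.sqrt (1 - ⟪m i j, e₃⟫_ℝ ^ 2)) →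
      (∀ i j, A₁ i '' fccRef = A₂ j '' fccRef → c i j = 0) →
      BilayerWallAt C R₀ σ₁ σ₂ L₁ L₂ s₁ s₂ c) :
    cc.tentBudget + cc.chargeSum + cc.unownedSlack ≤ (6 * (N : ℝ) - (numContacts x : ℝ)) + cc.tilingLoss₂ + cc.rimSum := by
  have h1 := cc.tiling₂_slack hR₀
  have h2 := cc.chargeSum_le hW
  have h3 := cc.hDef
  linarith

end CrustedCover

/-! ## The level-2 composition with slack -/

/-- **Level-2 composition over crusted cover + mesh WITH SLACK, adhesion hypothesis arbitrary**: «TB-cover» may exceed `θ·N^{2/3}` by the half-defects of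
the balls it leaves unowned. -/
theorem shadowTheoremSatAtomicV5_of_crustedAdh_slack {Adh : Prop}
    (hcover : BarlowResolution → Adh →
      ∀ C R₀ : ℝ, 1 ≤ R₀ → ∀ K δ θ : ℝ, 0 < δ → 0 < θ → ∃ N₀ : ℕ, ∀ N : ℕ, N₀ ≤ N → ∀ x : Fin N → E3, IsUnitPacking x →
        IsSaturated x → 6 * (N : ℝ) - (numContacts x : ℝ) ≤ K * (N : ℝ) ^ ((2 : ℝ) / 3) →
        ∃ (cc : CrustedCover C R₀ N x) (μ : Mesh cc.toCellCover δ),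
          cc.tilingLoss₂ + cc.rimSum + μ.gapCost ≤ θ * (N : ℝ) ^ ((2 : ℝ) / 3) + cc.unownedSlack)
    (henergy : PolytopeCalculus → BarlowFreeCertificate →
      ∀ (C R₀ : ℝ) (N : ℕ) (x : Fin N → E3) (δ : ℝ) (cv : CellCover C R₀ N x) (μ : Mesh cv δ),
        ∃ (n : ℕ) (G : Fin n → Set E3) (A : Fin n → (E3 ≃ₗᵢ[ℝ] E3)) (c : Fin n → Fin n → ℝ) (m : Fin n → Fin n → E3),
          IsTexture (13 / 25) (1 / 2) n G A c m ∧ (1 - δ) * (N : ℝ) ≤ Real.sqrt 2 * vol n G ∧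
          energy n G A c m ≤ cv.tentBudget + cv.chargeSum + μ.gapCost) :
    BarlowResolution → Adh → BilayerWallV5 → PolytopeCalculus → BarlowFreeCertificate → ShadowTheoremSatAtomicV5 := by
  intro hres hadh hBW hpoly hfree _hG _hC _hNRG _hSL K δ θ hδ hθ
  obtain ⟨C, R₀, hR₀, hW⟩ := hBW
  obtain ⟨N₀, hN₀⟩ := hcover hres hadh C R₀ hR₀ K δ θ hδ hθ
  refine ⟨N₀, fun N hN x hx hsat hK => ?_⟩
  obtain ⟨cc, μ, hslack⟩ := hN₀ N hN x hx hsat hK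
  obtain ⟨n, G, A, c, m, hT, hvol, hEn⟩ := henergy hpoly hfree C R₀ N x δ cc.toCellCover μ
  refine ⟨n, G, A, c, m, hT, hvol, ?_⟩
  have hdisc := cc.tentBudget_add_chargeSum_le₂_slack hR₀ hW
  have htb : cc.toCellCover.tentBudget = cc.tentBudget := rfl
  have hcs : cc.toCellCover.chargeSum = cc.chargeSum := rfl
  rw [htb, hcs] at hEn
  linarith

/-- **The v8.5 composition with slack**: TB-cover (T-form adhesion, slack target) + TB-energy ⇒ the registered shape of `stub_textureBuild`. -/
theorem textureBuildT_of_stubs_slack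
    (hcover : BarlowResolution → BarlowAdhesionT →
      ∀ C R₀ : ℝ, 1 ≤ R₀ → ∀ K δ θ : ℝ, 0 < δ → 0 < θ → ∃ N₀ : ℕ, ∀ N : ℕ, N₀ ≤ N → ∀ x : Fin N → E3, IsUnitPacking x →
        IsSaturated x → 6 * (N : ℝ) - (numContacts x : ℝ) ≤ K * (N : ℝ) ^ ((2 : ℝ) / 3) →
        ∃ (cc : CrustedCover C R₀ N x) (μ : Mesh cc.toCellCover δ),
          cc.tilingLoss₂ + cc.rimSum + μ.gapCost ≤ θ * (N : ℝ) ^ ((2 : ℝ) / 3) + cc.unownedSlack)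
    (henergy : PolytopeCalculus → BarlowFreeCertificate →
      ∀ (C R₀ : ℝ) (N : ℕ) (x : Fin N → E3) (δ : ℝ) (cv : CellCover C R₀ N x) (μ : Mesh cv δ),
        ∃ (n : ℕ) (G : Fin n → Set E3) (A : Fin n → (E3 ≃ₗᵢ[ℝ] E3)) (c : Fin n → Fin n → ℝ) (m : Fin n → Fin n → E3),
          IsTexture (13 / 25) (1 / 2) n G A c m ∧ (1 - δ) * (N : ℝ) ≤ Real.sqrt 2 * vol n G ∧
          energy n G A c m ≤ cv.tentBudget + cv.chargeSum + μ.gapCost) :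
    BarlowResolution → BarlowAdhesionT → BilayerWallV5 → PolytopeCalculus → BarlowFreeCertificate → ShadowTheoremSatV5 :=
  textureBuild_of_atomic (shadowTheoremSatAtomicV5_of_crustedAdh_slack hcover henergy)

end Summit.Ventures.Crystal3D.Cruxes.TextureLiminf.TexShadow

end
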